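import Literature.Probability.LatticeModels.CriticalTwoPointBounds
import Literature.Probability.LatticeModels.TwoPointSupNormMonotone
import Literature.Probability.LatticeModels.MessagerMiracleSole
import Literature.Probability.LatticeModels.HighDimPointwiseTriviality
import Literature.Probability.LatticeModels.SharpnessProofs
import HarnessLib

/-!
# An axis dip caps the susceptibility — stub `stub_axisDipSusceptibilityUpper`

Theorem file for stub `stub_axisDipSusceptibilityUpper` of line `diffusive-branch-is-nonsaturation`,
crux `PrecisionLaplacian.DirectCorrelationStableTail` (stmt-CriticalPhenomena-4799). Pure theorem
file (no definitions) about the critical two-point function `G := criticalTwoPoint 3 = ⟨σ₀σ_x⟩⁺_{β_c}`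
of the nearest-neighbour Ising model on `ℤ³` (sup norm `‖w‖_∞ = Site.supNorm w`, boxes
`Λ_L = box 3 L`, spheres `∂Λ_k = sphere 3 k`): there is `C` such that for `n, M ≥ 1` and every
`ε`, an axis dip `n · G(n e₁) < ε` forces `Σ_{‖w‖_∞ ≤ Mn} G(w) ≤ C n² + 27 M³ n² ε`.

* Inner region `‖w‖_∞ ≤ n - 1`: the infrared envelope `G(w) ≤ C₀/‖w‖_∞`
  (`exists_criticalTwoPoint_le_inv_pow`, i.e. `criticalTwoPoint_bounds_holds`,
  Fröhlich–Simon–Spencer / Duminil-Copin 2019 Thm. 4.8) and the sphere count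
  `#∂Λ_k ≤ 6(2k+1)² ≤ 54k²` (`card_sphere_succ_le`) give `Σ_{∂Λ_k} G ≤ 54 C₀ k + 1`, summed over
  `k < n`: `≤ (54 C₀ + 1) n²`.
* Outer region `n ≤ ‖w‖_∞ ≤ Mn`: Messager–Miracle-Solé (`twoPointPlus_le_axis_of_mem_sphere`,
  `twoPointPlus_add_single_le`, with `messager_miracleSole_holds`) gives
  `G(w) ≤ G(‖w‖_∞ e₁) ≤ G(n e₁) < ε/n` on at most `#Λ_{Mn} = (2Mn+1)³ ≤ 27 M³ n³` sites.
-/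

noncomputable section

namespace Summit.CriticalPhenomena.Ising3DConformalLimit.Cruxes.DirectCorrelationStableTail.DiffusiveBranchIsNonsaturation

open Finset
open Literature.Probability.LatticeModels
open scoped BigOperators

/-- MMS axis comparison at `β_c(3)`: if `n ≤ ‖w‖_∞` then `G(w) ≤ G(n e₁)` — first
`G(w) ≤ G(‖w‖_∞ e₁)` (Duminil-Copin 2019, eq. (4.10), left half), then monotonicity of `G` along
the first axis (Messager–Miracle-Solé). [cite: DuminilCopin2019, Exercise 37 (4), eq. (4.10), §4.3] -/
theorem axisDip_criticalTwoPoint_le_axis {n : ℕ} {w : Site 3} (h : n ≤ Site.supNorm w) :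
    criticalTwoPoint 3 w ≤ criticalTwoPoint 3 (Pi.single 0 (n : ℤ)) := by
  have hβ : 0 ≤ criticalBeta 3 := criticalBeta_nonneg 3
  have hMMS : ∀ {β : ℝ}, messager_miracleSole (d := 3) (β := β) := fun {β} =>
    messager_miracleSole_holds (d := 3) (β := β)
  have hd : 1 ≤ 3 := by norm_num
  have h1 := twoPointPlus_le_axis_of_mem_sphere hMMS twoPointPlus_reflection_invariant_holds
    twoPointPlus_perm_invariant_holds hβ hd (self_mem_sphere w)
  have key := twoPointPlus_add_single_le hMMS hβ (Pi.single (⟨0, hd⟩ : Fin 3) (n : ℤ))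
    ⟨0, hd⟩ (by simp) (Site.supNorm w - n)
  have hsum : (n : ℤ) + ((Site.supNorm w - n : ℕ) : ℤ) = (Site.supNorm w : ℤ) := by omega
  rw [← Pi.single_add, hsum] at key
  exact h1.trans key

/-- Sphere sums under the infrared envelope: if `G(v) ≤ C₀/‖v‖_∞` off the origin with `C₀ ≥ 0`,
then `Σ_{‖w‖_∞ = k} G(w) ≤ 54 C₀ k + 1` for every `k` (`k = 0`: the sphere is `{0}` and
`G(0) = 1`; `k = j + 1`: `#∂Λ_{j+1} ≤ 6(2j+3)² ≤ 54(j+1)²` and each term is `≤ C₀/(j+1)`). [folklore] -/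
theorem axisDip_sum_sphere_le {C₀ : ℝ} (hC₀ : 0 ≤ C₀)
    (hG : ∀ v : Site 3, v ≠ 0 → criticalTwoPoint 3 v ≤ C₀ / (Site.supNorm v : ℝ)) (k : ℕ) :
    ∑ w ∈ sphere 3 k, criticalTwoPoint 3 w ≤ 54 * C₀ * k + 1 := by
  rcases k with _ | j
  · have h0 : sphere 3 0 = {0} := by
      ext w
      rw [mem_sphere, Finset.mem_singleton, Site.supNorm_eq_zero_iff]
    rw [h0, Finset.sum_singleton, criticalTwoPoint_zero']
    simp
  · have ht : (0 : ℝ) < ((j + 1 : ℕ) : ℝ) := by positivity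
    have ht' : ((j + 1 : ℕ) : ℝ) ≠ 0 := ht.ne'
    have hterm : ∀ w ∈ sphere 3 (j + 1), criticalTwoPoint 3 w ≤ C₀ / ((j + 1 : ℕ) : ℝ) := by
      intro w hw
      rw [mem_sphere] at hw
      have hw0 : w ≠ 0 := fun h => by
        have := Site.supNorm_eq_zero_iff.2 h
        omega
      have := hG w hw0
      rwa [hw] at this
    have hsum : ∑ w ∈ sphere 3 (j + 1), criticalTwoPoint 3 w ≤
        (#(sphere 3 (j + 1)) : ℝ) * (C₀ / ((j + 1 : ℕ) : ℝ)) := by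
      rw [← nsmul_eq_mul]
      exact Finset.sum_le_card_nsmul _ _ _ hterm
    have hj : (0 : ℝ) ≤ j := Nat.cast_nonneg j
    have hcard : (#(sphere 3 (j + 1)) : ℝ) ≤ 54 * ((j + 1 : ℕ) : ℝ) ^ 2 := by
      refine (card_sphere_succ_le (d := 3) j).trans ?_
      push_cast
      norm_num
      nlinarith [mul_nonneg hj hj]
    calc ∑ w ∈ sphere 3 (j + 1), criticalTwoPoint 3 w
        ≤ (#(sphere 3 (j + 1)) : ℝ) * (C₀ / ((j + 1 : ℕ) : ℝ)) := hsum
      _ ≤ (54 * ((j + 1 : ℕ) : ℝ) ^ 2) * (C₀ / ((j + 1 : ℕ) : ℝ)) :=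
          mul_le_mul_of_nonneg_right hcard (div_nonneg hC₀ ht.le)
      _ = 54 * C₀ * ((j + 1 : ℕ) : ℝ) := by field_simp
      _ ≤ 54 * C₀ * ((j + 1 : ℕ) : ℝ) + 1 := by linarith

/-- **STUB 4 `stub_axisDipSusceptibilityUpper`** of line `diffusive-branch-is-nonsaturation` (crux
`PrecisionLaplacian.DirectCorrelationStableTail`, stmt-CriticalPhenomena-4799): an axis dip caps the
susceptibility. There is `C` such that for `n, M ≥ 1` and any `ε`, `n · G(n e₁) < ε` implies
`Σ_{‖w‖_∞ ≤ Mn} G(w) ≤ C n² + 27 M³ n² ε` (`G = criticalTwoPoint 3`). Inside `‖w‖_∞ < n`: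
`G ≤ C₀/‖w‖_∞` (infrared bound) and `#∂Λ_k ≤ 54 k²`; for `n ≤ ‖w‖_∞ ≤ Mn`:
`G(w) ≤ G(‖w‖_∞ e₁) ≤ G(n e₁) < ε/n` (Messager–Miracle-Solé) on `#Λ_{Mn} ≤ 27 M³ n³` sites.
Here `C = 54 C₀ + 1`. [cite: MessagerMiracleSoleJSP1977, main theorem (monotonicity of ⟨σ₀σ_x⟩ under reflections)] [cite: DuminilCopin2019, Exercise 37 (4), eq. (4.10), §4.3 and Thm. 4.8, §4.4] -/
theorem stub_axisDipSusceptibilityUpper : ∃ C : ℝ, ∀ (ε : ℝ) (n M : ℕ), 1 ≤ n → 1 ≤ M → (n : ℝ) * criticalTwoPoint 3 (Pi.single 0 (n : ℤ)) < ε → ∑ w ∈ box 3 (M * n), criticalTwoPoint 3 w ≤ C * (n : ℝ) ^ 2 + 27 * (M : ℝ) ^ 3 * (n : ℝ) ^ 2 * ε := by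
  obtain ⟨C₀, hC₀, hG'⟩ := exists_criticalTwoPoint_le_inv_pow (d := 3) le_rfl
  have hG : ∀ v : Site 3, v ≠ 0 → criticalTwoPoint 3 v ≤ C₀ / (Site.supNorm v : ℝ) :=
    fun v hv => by simpa [div_eq_mul_inv] using hG' v hv
  refine ⟨54 * C₀ + 1, fun ε n M hn hM hε => ?_⟩
  have hn0 : (0 : ℝ) < n := by exact_mod_cast hn
  have hn1 : (1 : ℝ) ≤ n := by exact_mod_cast hn
  have hε0 : 0 < ε := lt_of_le_of_lt (mul_nonneg hn0.le (criticalTwoPoint_nonneg' _)) hε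
  have haxis : criticalTwoPoint 3 (Pi.single 0 (n : ℤ)) < ε / n := by
    rw [lt_div_iff₀ hn0, mul_comm]
    exact hε
  have hMn : n ≤ M * n := le_mul_of_one_le_left (Nat.zero_le n) hM
  have hsub : box 3 (n - 1) ⊆ box 3 (M * n) := box_mono 3 (by omega)
  -- the inner region `‖w‖_∞ ≤ n - 1`
  have hinner : ∑ w ∈ box 3 (n - 1), criticalTwoPoint 3 w ≤ (54 * C₀ + 1) * (n : ℝ) ^ 2 := by
    have hfib : ∑ w ∈ box 3 (n - 1), criticalTwoPoint 3 w =
        ∑ k ∈ Finset.range n, ∑ w ∈ (box 3 (n - 1)).filter (fun w => Site.supNorm w = k),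
          criticalTwoPoint 3 w :=
      (Finset.sum_fiberwise_of_maps_to (fun w hw => by
        have := mem_box_iff_supNorm_le.1 hw
        rw [Finset.mem_range]
        omega) _).symm
    have hfiber : ∀ k ∈ Finset.range n,
        ∑ w ∈ (box 3 (n - 1)).filter (fun w => Site.supNorm w = k), criticalTwoPoint 3 w ≤
          54 * C₀ * n + 1 := by
      intro k hk
      have hkn : (k : ℝ) ≤ n := by exact_mod_cast (Finset.mem_range.1 hk).le
      calc ∑ w ∈ (box 3 (n - 1)).filter (fun w => Site.supNorm w = k), criticalTwoPoint 3 w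
          ≤ ∑ w ∈ sphere 3 k, criticalTwoPoint 3 w :=
            Finset.sum_le_sum_of_subset_of_nonneg
              (fun w hw => mem_sphere.2 (Finset.mem_filter.1 hw).2)
              (fun w _ _ => criticalTwoPoint_nonneg' w)
        _ ≤ 54 * C₀ * k + 1 := axisDip_sum_sphere_le hC₀ hG k
        _ ≤ 54 * C₀ * n + 1 := by nlinarith [mul_le_mul_of_nonneg_left hkn hC₀]
    rw [hfib]
    calc ∑ k ∈ Finset.range n,
          ∑ w ∈ (box 3 (n - 1)).filter (fun w => Site.supNorm w = k), criticalTwoPoint 3 w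
        ≤ ∑ _k ∈ Finset.range n, (54 * C₀ * n + 1 : ℝ) := Finset.sum_le_sum hfiber
      _ = n * (54 * C₀ * n + 1) := by
          rw [Finset.sum_const, Finset.card_range, nsmul_eq_mul]
      _ ≤ (54 * C₀ + 1) * (n : ℝ) ^ 2 := by
          nlinarith [mul_nonneg hn0.le (sub_nonneg.2 hn1)]
  -- the outer region `n ≤ ‖w‖_∞ ≤ M n`
  have houter : ∑ w ∈ box 3 (M * n) \ box 3 (n - 1), criticalTwoPoint 3 w ≤
      27 * (M : ℝ) ^ 3 * (n : ℝ) ^ 2 * ε := by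
    have hterm : ∀ w ∈ box 3 (M * n) \ box 3 (n - 1), criticalTwoPoint 3 w ≤ ε / n := by
      intro w hw
      simp only [Finset.mem_sdiff, mem_box_iff_supNorm_le, not_le] at hw
      exact (axisDip_criticalTwoPoint_le_axis (n := n) (w := w) (by omega)).trans haxis.le
    have hcard : (#(box 3 (M * n) \ box 3 (n - 1)) : ℝ) ≤ #(box 3 (M * n)) := by
      exact_mod_cast Finset.card_le_card Finset.sdiff_subset
    have hMn1 : (1 : ℝ) ≤ (M : ℝ) * n := by
      have h1 : 1 ≤ M * n := hn.trans hMn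
      exact_mod_cast h1
    have hpow : (2 * ((M : ℝ) * n) + 1) ^ 3 ≤ (3 * ((M : ℝ) * n)) ^ 3 :=
      pow_le_pow_left₀ (by positivity) (by linarith) 3
    calc ∑ w ∈ box 3 (M * n) \ box 3 (n - 1), criticalTwoPoint 3 w
        ≤ (#(box 3 (M * n) \ box 3 (n - 1)) : ℝ) * (ε / n) := by
          rw [← nsmul_eq_mul]
          exact Finset.sum_le_card_nsmul _ _ _ hterm
      _ ≤ (#(box 3 (M * n)) : ℝ) * (ε / n) :=
          mul_le_mul_of_nonneg_right hcard (div_nonneg hε0.le hn0.le)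
      _ = (2 * ((M : ℝ) * n) + 1) ^ 3 * (ε / n) := by
          rw [card_box]
          push_cast
          ring
      _ ≤ (3 * ((M : ℝ) * n)) ^ 3 * (ε / n) :=
          mul_le_mul_of_nonneg_right hpow (div_nonneg hε0.le hn0.le)
      _ = 27 * (M : ℝ) ^ 3 * (n : ℝ) ^ 2 * ε := by
          field_simp
          ring
  rw [← Finset.sum_sdiff hsub]
  linarith [hinner, houter]

end Summit.CriticalPhenomena.Ising3DConformalLimit.Cruxes.DirectCorrelationStableTail.DiffusiveBranchIsNonsaturation

end
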